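import Literature.Combinatorics.Optimization.CompletelyPsdRank
import Literature.Combinatorics.Optimization.HornMatrix
import HarnessLib

/-!
# `CP⁵ ≠ CS_+⁵`: the matrix `M_ij = cos²(4π(i−j)/5)` is completely psd but not completely positive,
# certified by the Horn form (FGPRT 2015, §8) — PROVED

Source: H. Fawzi, J. Gouveia, P. A. Parrilo, R. Z. Robinson, R. R. Thomas, *Positive semidefinite rank*,
Math. Program. Ser. B 153 (2015) 133–177 = arXiv:1407.4095 [FawziEtAl2015], §8 "Symmetric
factorizations" (held text `paper:arxiv-1407.4095`, chunk p23; arXiv numbering), verbatim: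

> When `n ≤ 4` it is known that `CP^n = DN^n` and thus the inclusions (`CP^n ⊆ CS^n ⊆ DN^n`) are all
> equalities. It is known that for `n = 5` the two inclusions are strict [laurent2013conic,
> frenkel2010vector]: To show that `CP^5 ≠ CS^5`, one can consider the `5 × 5` matrix `M` defined by
> `M_{ij} = cos²((4π/5)(i − j))`, `i,j = 1,…,5`. The matrix `M` is completely psd since it admits the
> factorization `M_{ij} = ⟨a_i a_iᵀ, a_j a_jᵀ⟩` where `a_i = (cos(4πi/5), sin(4πi/5)) ∈ ℝ²`. On the
> other hand `M ∉ CP^5` since `⟨H, M⟩ < 0` where `H` is an element of the dual cone `(CP^5)^*` known as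
> the Horn form: `H = [[1,−1,1,1,−1],[−1,1,−1,1,1],[1,−1,1,−1,1],[1,1,−1,1,−1],[−1,1,1,−1,1]]`.

Vocabulary (all from the tree): `IsCp`, `IsCpsd`, `HasCpFactorization` and the Gram–Lorentz route
`IsGramLorentz.isCpsd` of `CompletelyPsdRank.lean` (A. Prakash, J. Sikora, A. Varvitsiotis, Z. Wei
[PrakashEtAl2017], §1.1 / Lemma 7); the Horn matrix `HornMatrix.hornMatrix` with its copositivity
`HornMatrix.isCopositive_hornMatrix` (`HornMatrix.lean`); `IsCopositive` of
`MotzkinStrausCopositive.lean`. The tree already has `CP⁴ = DNN⁴` (`IsDnn.isCp_fin_four`), `CS_+⁵ ≠ DNN⁵`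
(the `5`-cycle, `CpsdGraphs.lean`) and PSVW Corollary 1 (`cyclicLorentzGram_isCpsd_not_isCp`, sizes
`2ℓ ≥ 6`); the `5 × 5` separation `CP⁵ ≠ CS_+⁵` by the printed matrix was missing.

Contents (all PROVED; no definitions, no named facts). The printed matrix is written inline as
`Matrix.of fun i j : Fin 5 => cos(4π/5 · (i − j))²` (indices `0,…,4`; only `i − j` matters).
* `sum_mul_nonneg_of_isCopositive_of_isCp` — "`H` is an element of the dual cone `(CP^5)^*`": a
  copositive `H` pairs nonnegatively with every completely positive matrix (any finite index type).
* `FawziEtAl2015_sec8_factorization` — the printed factorization `M_ij = ⟨a_ia_iᵀ, a_ja_jᵀ⟩ = ⟨a_i, a_j⟩²`.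
* `FawziEtAl2015_sec8_isCpsd` — `M ∈ CS_+⁵` (through the tree's Gram–Lorentz criterion:
  `cos²(θ_i − θ_j) = ½·1 + ½(cos 2θ_i cos 2θ_j + sin 2θ_i sin 2θ_j)`; the printed real `2 × 2` factors
  give the same conclusion, the tree's `CS_+` being defined with Hermitian factors).
* `FawziEtAl2015_sec8_hornPairing` — `⟨H, M⟩ = 5 − (5/2)√5` (both matrices are circulant; per residue
  of `i − j` the entries of `M` are `1`, `(1 + cos(2π/5))/2`, `(1 + cos(4π/5))/2`, and
  `cos(4π/5) − cos(2π/5) = −√5/2`), hence `⟨H, M⟩ < 0` (`FawziEtAl2015_sec8_hornPairing_neg`).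
* `FawziEtAl2015_sec8_not_isCp`, `FawziEtAl2015_sec8_cp_ne_cpsd_five` — `M ∉ CP⁵`; `CP⁵ ⊊ CS_+⁵`.
-/

noncomputable section

open Matrix Finset Real

namespace Literature.Combinatorics.Optimization

open Literature.Combinatorics.Optimization.MotzkinStrausCopositive (IsCopositive)
open Literature.Combinatorics.Optimization.HornMatrix (hornMatrix isCopositive_hornMatrix)

/-! ### Copositive matrices pair nonnegatively with completely positive ones -/

/-- **"`H` is an element of the dual cone `(CP^n)^*`"**: for a copositive `H` and a completely positive
`X = Σ_l p_l p_lᵀ` (`p_l ≥ 0`), `⟨H, X⟩ = Σ_l p_lᵀ H p_l ≥ 0`. [cite: FawziEtAl2015, §8 (p23)] -/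
theorem sum_mul_nonneg_of_isCopositive_of_isCp {ι : Type*} [Fintype ι] {H X : Matrix ι ι ℝ}
    (hH : IsCopositive H) (hX : IsCp X) : 0 ≤ ∑ i, ∑ j, H i j * X i j := by
  obtain ⟨d, p, hp, hXp⟩ := hX
  have h1 : ∑ i, ∑ j, H i j * X i j = ∑ l, (fun i => p i l) ⬝ᵥ H *ᵥ (fun i => p i l) := by
    calc ∑ i, ∑ j, H i j * X i j = ∑ i, ∑ j, ∑ l, p i l * (H i j * p j l) := by
          refine sum_congr rfl fun i _ => sum_congr rfl fun j _ => ?_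
          rw [hXp, Finset.mul_sum]
          exact sum_congr rfl fun l _ => by ring
      _ = ∑ i, ∑ l, ∑ j, p i l * (H i j * p j l) :=
          sum_congr rfl fun i _ => Finset.sum_comm
      _ = ∑ l, ∑ i, ∑ j, p i l * (H i j * p j l) := Finset.sum_comm
      _ = ∑ l, (fun i => p i l) ⬝ᵥ H *ᵥ (fun i => p i l) := by
          refine sum_congr rfl fun l _ => ?_
          simp only [dotProduct, mulVec, Finset.mul_sum]
  rw [h1]
  exact sum_nonneg fun l _ => hH _ fun i => hp i l

/-! ### The printed factorization and `M ∈ CS_+⁵` -/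

/-- **FGPRT §8, the factorization** (p23: "`M_{ij} = ⟨a_i a_iᵀ, a_j a_jᵀ⟩` where
`a_i = (cos(4πi/5), sin(4πi/5)) ∈ ℝ²`"): `⟨a_ia_iᵀ, a_ja_jᵀ⟩ = ⟨a_i,a_j⟩² = cos²(4π(i−j)/5)`.
[cite: FawziEtAl2015, §8 (p23)] -/
theorem FawziEtAl2015_sec8_factorization (i j : Fin 5) :
    (vecMulVec ![cos (4 * π * i / 5), sin (4 * π * i / 5)] ![cos (4 * π * i / 5), sin (4 * π * i / 5)] *
        vecMulVec ![cos (4 * π * j / 5), sin (4 * π * j / 5)]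
          ![cos (4 * π * j / 5), sin (4 * π * j / 5)]).trace =
      cos (4 * π / 5 * ((i : ℝ) - j)) ^ 2 := by
  rw [vecMulVec_mul_vecMulVec, trace_vecMulVec, dotProduct_smul, smul_eq_mul]
  have h : ![cos (4 * π * i / 5), sin (4 * π * i / 5)] ⬝ᵥ ![cos (4 * π * j / 5), sin (4 * π * j / 5)] =
      cos (4 * π / 5 * ((i : ℝ) - j)) := by
    rw [show 4 * π / 5 * ((i : ℝ) - j) = 4 * π * i / 5 - 4 * π * j / 5 by ring, cos_sub]
    simp [dotProduct, Fin.sum_univ_two]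
  rw [h, sq]

/-- **FGPRT §8, "The matrix `M` is completely psd"** (p23). Route: `M` is Gram–Lorentz —
`cos²(θ_i − θ_j) = c_ic_j + ⟨x_i, x_j⟩` with `c_i = 1/√2`, `x_i = (cos 2θ_i, sin 2θ_i)/√2`, `‖x_i‖ = c_i` —
so the tree's `IsGramLorentz.isCpsd` (PSVW Lemma 7) applies. [cite: FawziEtAl2015, §8 (p23)] -/
theorem FawziEtAl2015_sec8_isCpsd :
    IsCpsd (Matrix.of fun i j : Fin 5 => cos (4 * π / 5 * ((i : ℝ) - j)) ^ 2) := by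
  refine IsGramLorentz.isCpsd ⟨2, fun _ => 1 / Real.sqrt 2,
    fun i => ![cos (2 * (4 * π / 5 * i)) / Real.sqrt 2, sin (2 * (4 * π / 5 * i)) / Real.sqrt 2],
    fun i => ?_, fun i j => ?_⟩
  · have h2 : (0 : ℝ) < Real.sqrt 2 := Real.sqrt_pos.mpr (by norm_num)
    have hsum : ∑ l : Fin 2, (![cos (2 * (4 * π / 5 * i)) / Real.sqrt 2,
        sin (2 * (4 * π / 5 * i)) / Real.sqrt 2] l) ^ 2 = (1 / Real.sqrt 2) ^ 2 := by
      simp only [Fin.sum_univ_two, Matrix.cons_val_zero, Matrix.cons_val_one]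
      rw [div_pow, div_pow, ← add_div, cos_sq_add_sin_sq, div_pow, one_pow]
    rw [hsum, Real.sqrt_sq (by positivity)]
  · simp only [Matrix.of_apply, Fin.sum_univ_two, Matrix.cons_val_zero, Matrix.cons_val_one]
    have h2 : Real.sqrt 2 ^ 2 = 2 := Real.sq_sqrt (by norm_num)
    rw [cos_sq, show 2 * (4 * π / 5 * ((i : ℝ) - j)) = 2 * (4 * π / 5 * i) - 2 * (4 * π / 5 * j) by ring,
      cos_sub]
    field_simp
    rw [h2]
    ring

/-! ### The Horn pairing `⟨H, M⟩ = 5 − (5/2)√5 < 0` and `M ∉ CP⁵` -/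

/-- The entries of `M` depend only on `i − j (mod 5)`:
`cos²(4π(i−j)/5) = (1 + cos(2π·r/5))/2` with `r = (i − j) mod 5` (since `cos(8πd/5) = cos(2πd/5)` for
integers `d`). [cite: FawziEtAl2015, §8 (p23)] -/
private theorem cosSq_eq_of_sub (i j : Fin 5) :
    cos (4 * π / 5 * ((i : ℝ) - j)) ^ 2 = (1 + cos (2 * π * ((i - j : Fin 5) : ℕ) / 5)) / 2 := by
  rw [cos_sq]
  have hd : (((i - j : Fin 5) : ℕ) : ℝ) = (i : ℝ) - j + (if j ≤ i then (0 : ℝ) else 5) := by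
    have h := Fin.intCast_val_sub_eq_sub_add_ite i j
    have h' : (((i - j : Fin 5) : ℕ) : ℝ) = (((i - j : Fin 5).val : ℤ) : ℝ) := by norm_cast
    rw [h', h]
    split_ifs <;> push_cast <;> ring
  have hcos : cos (2 * (4 * π / 5 * ((i : ℝ) - j))) = cos (2 * π * ((i - j : Fin 5) : ℕ) / 5) := by
    rw [hd]
    split_ifs with hle
    · -- `8πd/5 = d·2π − 2πd/5`
      rw [add_zero, show 2 * (4 * π / 5 * ((i : ℝ) - j)) =
          (((i : ℤ) - j : ℤ) : ℝ) * (2 * π) - 2 * π * ((i : ℝ) - j) / 5 by push_cast; ring,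
        cos_int_mul_two_pi_sub]
    · -- `8πd/5 = (d+1)·2π − 2π(d+5)/5`
      rw [show 2 * (4 * π / 5 * ((i : ℝ) - j)) =
          (((i : ℤ) - j + 1 : ℤ) : ℝ) * (2 * π) - 2 * π * ((i : ℝ) - j + 5) / 5 by push_cast; ring,
        cos_int_mul_two_pi_sub]
  rw [hcos]
  ring

/-- The Horn matrix is circulant: `H_ij = h(i − j)` with `h = (1,−1,1,1,−1)`. [cite: FawziEtAl2015, §8 (p23)] -/
private theorem hornMatrix_eq_of_sub (i j : Fin 5) :
    hornMatrix i j = (![1, -1, 1, 1, -1] : Fin 5 → ℝ) (i - j) := by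
  fin_cases i <;> fin_cases j <;> simp [hornMatrix]

/-- A double sum of a function of `i − j` over `Fin 5 × Fin 5` is `5` times the single sum. [folklore] -/
private theorem sum_sum_sub_eq (F : Fin 5 → ℝ) : ∑ i : Fin 5, ∑ j : Fin 5, F (i - j) = 5 * ∑ d, F d := by
  have h : ∀ i : Fin 5, ∑ j : Fin 5, F (i - j) = ∑ d, F d := fun i =>
    Equiv.sum_comp (Equiv.subLeft i) F
  simp only [h, sum_const, card_univ, Fintype.card_fin, nsmul_eq_mul, Nat.cast_ofNat]

/-- `cos(2π/5) = (√5 − 1)/4` (from `cos(π/5) = (1 + √5)/4` and the double-angle formula). [folklore] -/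
private theorem cos_two_pi_div_five' : cos (2 * π / 5) = (Real.sqrt 5 - 1) / 4 := by
  rw [show 2 * π / 5 = 2 * (π / 5) by ring, cos_two_mul, cos_pi_div_five]
  have h5 : Real.sqrt 5 ^ 2 = 5 := Real.sq_sqrt (by norm_num)
  nlinarith [h5]

/-- `cos(4π/5) = −(1 + √5)/4`. [folklore] -/
private theorem cos_four_pi_div_five' : cos (4 * π / 5) = -((1 + Real.sqrt 5) / 4) := by
  rw [show 4 * π / 5 = π - π / 5 by ring, cos_pi_sub, cos_pi_div_five]

/-- **FGPRT §8, the Horn pairing** (p23: "`⟨H, M⟩ < 0`"), exact value: `⟨H, M⟩ = 5 − (5/2)√5`.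
[cite: FawziEtAl2015, §8 (p23)] -/
theorem FawziEtAl2015_sec8_hornPairing :
    ∑ i : Fin 5, ∑ j : Fin 5, hornMatrix i j * cos (4 * π / 5 * ((i : ℝ) - j)) ^ 2 =
      5 - 5 / 2 * Real.sqrt 5 := by
  set G : Fin 5 → ℝ := fun d => (![1, -1, 1, 1, -1] : Fin 5 → ℝ) d *
    ((1 + cos (2 * π * (d : ℕ) / 5)) / 2) with hG
  have h1 : ∀ i j : Fin 5, hornMatrix i j * cos (4 * π / 5 * ((i : ℝ) - j)) ^ 2 = G (i - j) := by
    intro i j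
    rw [hornMatrix_eq_of_sub, cosSq_eq_of_sub]
  have h2 : ∑ i : Fin 5, ∑ j : Fin 5, hornMatrix i j * cos (4 * π / 5 * ((i : ℝ) - j)) ^ 2 =
      ∑ i : Fin 5, ∑ j : Fin 5, G (i - j) :=
    sum_congr rfl fun i _ => sum_congr rfl fun j _ => h1 i j
  rw [h2, sum_sum_sub_eq G]
  simp only [hG, Fin.sum_univ_five, Matrix.cons_val_zero, Matrix.cons_val_one, Matrix.cons_val]
  have v0 : (((0 : Fin 5) : ℕ) : ℝ) = 0 := by norm_num
  have v1 : (((1 : Fin 5) : ℕ) : ℝ) = 1 := by norm_num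
  have v2 : (((2 : Fin 5) : ℕ) : ℝ) = 2 := by norm_num
  have v3 : (((3 : Fin 5) : ℕ) : ℝ) = 3 := by norm_num
  have v4 : (((4 : Fin 5) : ℕ) : ℝ) = 4 := by norm_num
  rw [v0, v1, v2, v3, v4]
  have c0 : cos (2 * π * 0 / 5) = 1 := by rw [mul_zero, zero_div, cos_zero]
  have c1 : cos (2 * π * 1 / 5) = (Real.sqrt 5 - 1) / 4 := by rw [mul_one, cos_two_pi_div_five']
  have c2 : cos (2 * π * 2 / 5) = -((1 + Real.sqrt 5) / 4) := by
    rw [show 2 * π * 2 / 5 = 4 * π / 5 by ring, cos_four_pi_div_five']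
  have c3 : cos (2 * π * 3 / 5) = -((1 + Real.sqrt 5) / 4) := by
    rw [show 2 * π * 3 / 5 = 2 * π - 4 * π / 5 by ring, cos_two_pi_sub, cos_four_pi_div_five']
  have c4 : cos (2 * π * 4 / 5) = (Real.sqrt 5 - 1) / 4 := by
    rw [show 2 * π * 4 / 5 = 2 * π - 2 * π / 5 by ring, cos_two_pi_sub, cos_two_pi_div_five']
  rw [c0, c1, c2, c3, c4]
  ring

/-- Hence `⟨H, M⟩ < 0` (`√5 > 2`). [cite: FawziEtAl2015, §8 (p23)] -/
theorem FawziEtAl2015_sec8_hornPairing_neg :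
    ∑ i : Fin 5, ∑ j : Fin 5, hornMatrix i j * cos (4 * π / 5 * ((i : ℝ) - j)) ^ 2 < 0 := by
  rw [FawziEtAl2015_sec8_hornPairing]
  have h : (2 : ℝ) < Real.sqrt 5 := by
    rw [show (2 : ℝ) = Real.sqrt 4 by rw [show (4 : ℝ) = 2 ^ 2 by norm_num, Real.sqrt_sq (by norm_num)]]
    exact Real.sqrt_lt_sqrt (by norm_num) (by norm_num)
  linarith

/-- **FGPRT §8, "`M ∉ CP^5` since `⟨H, M⟩ < 0` where `H` is an element of the dual cone `(CP^5)^*`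
known as the Horn form"** (p23). [cite: FawziEtAl2015, §8 (p23)] -/
theorem FawziEtAl2015_sec8_not_isCp :
    ¬ IsCp (Matrix.of fun i j : Fin 5 => cos (4 * π / 5 * ((i : ℝ) - j)) ^ 2) := by
  intro h
  have h1 := sum_mul_nonneg_of_isCopositive_of_isCp isCopositive_hornMatrix h
  simp only [Matrix.of_apply] at h1
  exact absurd FawziEtAl2015_sec8_hornPairing_neg (not_lt.mpr h1)

/-- **FGPRT §8, `CP⁵ ≠ CS⁵`** (p23: "To show that `CP^5 ≠ CS^5`, one can consider the `5 × 5` matrix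
`M` defined by `M_{ij} = cos²((4π/5)(i − j))`"): the printed matrix lies in `CS_+⁵ \ CP⁵`; in particular
the inclusion `CP⁵ ⊆ CS_+⁵` (`IsCp.isCpsd`) is strict. [cite: FawziEtAl2015, §8 (p23)] -/
theorem FawziEtAl2015_sec8_cp_ne_cpsd_five :
    (IsCpsd (Matrix.of fun i j : Fin 5 => cos (4 * π / 5 * ((i : ℝ) - j)) ^ 2) ∧
      ¬ IsCp (Matrix.of fun i j : Fin 5 => cos (4 * π / 5 * ((i : ℝ) - j)) ^ 2)) ∧
    {X : Matrix (Fin 5) (Fin 5) ℝ | IsCp X} ⊂ {X : Matrix (Fin 5) (Fin 5) ℝ | IsCpsd X} :=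
  ⟨⟨FawziEtAl2015_sec8_isCpsd, FawziEtAl2015_sec8_not_isCp⟩,
    ⟨fun _ hX => IsCp.isCpsd hX, fun h => FawziEtAl2015_sec8_not_isCp (h FawziEtAl2015_sec8_isCpsd)⟩⟩

end Literature.Combinatorics.Optimization
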